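import Summits.AtomisticToContinuum.Crystallization.Theses.ReggeStarCoercivity
import Literature.MathematicalPhysics.StatisticalMechanics.PeriodicConfigurationSums
import Literature.Algebra.EuclideanLattices.IntegerBases

/-!
# Disproof work file — `PeriodicStarCoercivity` (stmt-AtomisticToContinuum-13602), standing disprover gen 2

Crux (route `ReggeStarCoercivity`, rank 4):
`∃ g > 0, ∀ P : PeriodicConfiguration 3, ePer + g · (#defective motif points)/(#motif) ≤ e(P)`,
`ePer = ⨅_Q e(Q)` (Lennard-Jones, Blanc–Lewin units `V = r⁻¹²/12 − r⁻⁶/6`), a motif point `s` being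
*defective* unless, for some scale `a ∈ [9/10, 11/10]` and some linear isometry `A`, the recentred shell
`{y − s : y ∈ P.points, 0 < |y − s| ≤ 6/5}` rescaled by `a⁻¹` is `1/20`-matched by a bijection to
`A(fcc pattern)` or `A(hcp pattern)` (twelve unit vectors each).

## Findings index (this file; prose only in docstrings/comments)

* §1 Named pieces: `shell`, `IsFree`, `defectSet`, `defectFrac`, `ePer`, `PSCAt`; `psc_iff` (the crux is
  literally `∃ g > 0, ∀ P, PSCAt g P`), `pscAt_iff` (re-association `g * #def / #motif = g * defectFrac`).
* §2 Load-bearing analysis (gen 2):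
  - `not_isFree_of_card_ne` — a shell with `≠ 12` points inside radius `6/5` is defective whatever the
    scale window: the ABSOLUTE radius `6/5` plus the forced cardinality `12` already pins the nearest-neighbour
    distance of a free close-packed shell to `(6/5/√2, 6/5] = (0.8485…, 1.2]`; the window `a ∈ [9/10, 11/10]`
    with tolerance `1/20` allows `d ∈ [0.855, 1.155]` — so the window is NOT load-bearing except on
    configurations whose excess energy is `≥ 0.3` per particle (numerics, §N). `psc_imp_pscNoWindow` records
    the formal direction (dropping the window weakens the statement).
  - `siteCoercivity_imp_psc` — the per-site strengthening (charge each defective SITE `g` against its own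
    half site-energy) implies the crux by averaging; §5 explains why even this stronger statement cannot be
    refuted without structural knowledge of near-minimisers (dead end recorded, not a sorry).
* §3 Ceilings on `g` (tightness side): `PSCAt.mono`, `g_le_of_allDefective` (every everywhere-defective `P`
  gives `g ≤ e(P) − ePer`); quantitative use needs a LOWER bound on `ePer` — see §4.
* §4 `ePer` is a genuine infimum — PROVED (gen 2, 2026-08-15T23:24Z): companion evidence file
  `PeriodicStability.lean` (sorry-free, rc0, std axioms; attached to this item and to shared item
  stmt-AtomisticToContinuum-0714 `CrysPeriodicBddBelow` for a prover to land in Literature) proves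
  `PeriodicConfiguration.energyPerParticle_lennardJones_ge (hd : d ≤ 5) : ∀ P, −3·2²⁹ ≤ e_LJ(P)` by
  closest-orbit peeling (minimal distance attained at a motif point; remove that orbit; re-index the cross
  term to sums seen from `x₀`; dyadic packing bound in `tsum` form; induction on `#motif`) and hence
  `BddBelow (range e_LJ)` = 0714 verbatim. It cannot be imported here before it lands, so §4 below states the
  consequences against a hypothesis `hB : ∀ Q, B ≤ e Q` (`psc_imp_bddBelow`, `ePer_le`, `le_ePer`,
  `g_le_of_allDefective_of_lowerBound`). SECOND evidence file `PeriodicBlocks.lean` (gen 2, sorry-free rc0, std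
  axioms; attached to 13602, 11865, 0714, 0626): trial BLOCKS of a periodic configuration
  (`exists_block_energy_le : ∀ ε > 0, ∃ N > 0, ∃ x injective, E_LJ(x) ≤ N (e(P) + ε)`), hence
  `e_∞ ≤ e(P)`, `limsup E(N)/N ≤ ⨅_Q e(Q)` (= shared item 11865 `CrysEnergyUpper`, verbatim) and, with the
  tree's `Yuhjtman2015_stabilityConstant_holds`, the explicit floor `e(P) ≥ −14.316/12` for every periodic
  `P ⊂ ℝ³`. §4b builds the everywhere-defective dilute cubic `2ℤ³` in-file (empty first shell, `e ≤ 0`) and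
  derives `psc_imp_ePer_neg`, `g_le_neg_ePer`, and — modulo the hypothesis `hY : ∀ Q, −14.316/12 ≤ e Q` that
  `PeriodicBlocks.lean` discharges — `g_le_yuhjtman : g ≤ 14.316/12` and the refuted strengthening
  `not_pscAt_six_fifths`. §4c builds bcc at nearest-neighbour distance `(11/20)√3 ≈ 0.9526` in-file
  (`ZLattice.comap` of the integer lattice `L(bccMat)` along `x ↦ (20/11)x`): `14` explicit points within
  `6/5` make every site over-coordinated (defective for every window), and a CERTIFIED partial lattice sum over
  the first five shells (58 points; all omitted terms `≤ 0` because every pair distance is `≥ 0.95 > 2^{-1/6}`;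
  `decide +kernel` on the label multiset, `norm_num` on rationals) gives `e(bcc) ≤ −0.633`; hence
  `ePer ≤ −0.633` (mod `BddBelow`) and `g ≤ 0.56` (mod the Yuhjtman floor): `not_pscAt_three_fifths`.
  A ceiling at the `10⁻²` scale needs `B ≈ −0.73` (energetic crystallization).
* §5 Near-misses / dead ends (comments): per-site variant; shell-radius variants `R ≠ 6/5` ("morally false"
  for `R ≥ √2·d* ≈ 1.374` or `R < d* ≈ 0.971`, unprovable without the minimiser); 13th-neighbour intrusion;
  two-phase and porous families (ratio bounded below by surface energy).
* §N Numerics (kit, floating point; job ids in NOTES/evidence): implied ceilings `g ≤ M(e − e_hcp)/#def` over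
  strained/shuffled/defected close packings — smallest found so far by predecessors ≈ 5·10⁻³ (hcp optical
  shuffle at the 1/20 fit threshold); gen-2 job `psc_defect_cost.py` adds constrained relaxation of single
  defective sites, layer-shift patterns and relaxed point defects (results appended below when in).

## Predecessor results (gen 1 `refuter-cdisprove-…-13602-0` and `refuter-rattack-…-13602-0`; item evidence
`Disproof.lean` v3 2026-08-15T22:48Z, `Evidence13602.lean`, `crux_attack_13602.md` — NOT reproduced here,
cite by name): `psc_iff`/`PSCWith η lo hi`, `PSCWith.mono`, `bddBelow_range_e ↔` content of `g = 0`,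
`not_psc_of_isLeast`/`not_psc_of_seq`/`not_psc_iff`, `defectFrac_eq_zero_of_isLeast`,
`tendsto_defectFrac_zero`, refuted strengthenings `not_periodicStarCoercivityForallG` (∀ g),
`not_pscWith_zero` (tolerance `η = 0`, minimiser-free: generic shear `id + tN`, tight-frame rigidity of the
patterns, Tannery continuity), `not_pscCount` (count instead of fraction), `admissible_g_le_of_lowerBound`;
infrastructure `linImage`, `energyPerParticle_linImage`, `tendsto_energy_shear`.

## Verdict so far
RESISTS. Every quantitative witness `e(P) < ePer + g·frac(P)` needs either a certified LOWER bound on `ePer`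
within `~10⁻²` of `e(hcp) ≈ −0.7176` (= energetic crystallization, open) or a non-Barlow periodic structure
provably tying `ePer` (none known; all explicit competitors sit `≥ 5·10⁻³ · frac` above `e(hcp)`).
-/

noncomputable section

open scoped BigOperators Classical
open Literature.MathematicalPhysics.StatisticalMechanics Literature.Geometry.DiscreteGeometry

namespace Summit.AtomisticToContinuum.Crystallization.Cruxes.PeriodicStarCoercivity.Disproof

local notation "E3" => EuclideanSpace ℝ (Fin 3)
local notation "PC" => PeriodicConfiguration 3

/-! ## §1 Named pieces of the crux -/

/-- The recentred first shell of `s` in `P` (other points within ABSOLUTE radius `6/5`), rescaled by `a⁻¹`,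
exactly as written in the crux. -/
def shell (P : PC) (s : E3) (a : ℝ) : Finset E3 :=
  (P.finite_inter_points (K := Metric.closedBall s (6 / 5) \ {s})
      (Metric.isBounded_closedBall.subset Set.sdiff_subset)).toFinset.image fun y => a⁻¹ • (y - s)

/-- `s` is a FREE (non-defective) site of `P`: some admissible rescaling of its shell is `1/20`-close to the
fcc or the hcp kissing pattern. -/
def IsFree (P : PC) (s : E3) : Prop :=
  ∃ a : ℝ, 9 / 10 ≤ a ∧ a ≤ 11 / 10 ∧
    (ShellCloseTo (1 / 20) (shell P s a) fccKissingPattern ∨ ShellCloseTo (1 / 20) (shell P s a) hcpKissingPattern)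

/-- The defective motif points. -/
def defectSet (P : PC) : Finset E3 := P.motif.filter fun s => ¬ IsFree P s

/-- The defect fraction `#defective / #motif ∈ [0, 1]`. -/
def defectFrac (P : PC) : ℝ := ((defectSet P).card : ℝ) / (P.motif.card : ℝ)

/-- `ePer = ⨅_Q e_LJ(Q)` over all periodic configurations of `ℝ³`. -/
def ePer : ℝ := ⨅ Q : PC, Q.energyPerParticle lennardJones

/-- Shorthand for the Lennard-Jones energy per particle. -/
def e (P : PC) : ℝ := P.energyPerParticle lennardJones

/-- The body of the crux at a given `g` and `P`, in the crux's own left-associated form. -/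
def PSCAt (g : ℝ) (P : PC) : Prop :=
  ePer + g * ((defectSet P).card : ℝ) / (P.motif.card : ℝ) ≤ e P

/-- The crux is literally `∃ g > 0, ∀ P, PSCAt g P`. -/
theorem psc_iff :
    Summit.AtomisticToContinuum.Crystallization.Theses.ReggeStarCoercivity.PeriodicStarCoercivity ↔
      ∃ g : ℝ, 0 < g ∧ ∀ P : PC, PSCAt g P :=
  Iff.rfl

/-- Re-association: `g * #def / #motif = g * defectFrac`. -/
theorem pscAt_iff (g : ℝ) (P : PC) : PSCAt g P ↔ ePer + g * defectFrac P ≤ e P := by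
  unfold PSCAt defectFrac
  rw [mul_div_assoc]

theorem motif_card_pos (P : PC) : 0 < (P.motif.card : ℝ) :=
  Nat.cast_pos.2 (Finset.card_pos.2 P.motif_nonempty)

theorem defectFrac_nonneg (P : PC) : 0 ≤ defectFrac P :=
  div_nonneg (Nat.cast_nonneg _) (Nat.cast_nonneg _)

theorem defectFrac_le_one (P : PC) : defectFrac P ≤ 1 := by
  unfold defectFrac
  rw [div_le_one (motif_card_pos P)]
  exact_mod_cast Finset.card_filter_le _ _

/-- All sites defective ⇒ defect fraction `1`. -/
theorem defectFrac_eq_one_of_forall {P : PC} (h : ∀ s ∈ P.motif, ¬ IsFree P s) : defectFrac P = 1 := by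
  unfold defectFrac defectSet
  rw [Finset.filter_true_of_mem h, div_self (motif_card_pos P).ne']

/-! ## §2 Load-bearing analysis -/

/-- The rescaling map of the shell is injective (`a ≠ 0`), so the rescaled shell has as many points as the
raw shell. -/
theorem card_shell (P : PC) (s : E3) {a : ℝ} (ha : a ≠ 0) :
    (shell P s a).card =
      (P.finite_inter_points (K := Metric.closedBall s (6 / 5) \ {s})
        (Metric.isBounded_closedBall.subset Set.sdiff_subset)).toFinset.card := by
  unfold shell
  refine Finset.card_image_of_injective _ fun y y' h => ?_
  have h' : a⁻¹ • (y - s) = a⁻¹ • (y' - s) := h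
  have := smul_right_injective E3 (inv_ne_zero ha) h'
  simpa using this

/-- **Cardinality is forced.** If the raw first shell (other points of `P` within radius `6/5` of `s`) does
not have exactly twelve points, `s` is defective — for EVERY scale window: the defect test charges every
under/over-coordinated site (vacancy neighbours, surfaces, dilute lattices, bcc 8/14 shells, second-shell
intrusion at `√2 d ≤ 6/5`). -/
theorem not_isFree_of_card_ne (P : PC) (s : E3)
    (h : (P.finite_inter_points (K := Metric.closedBall s (6 / 5) \ {s})
        (Metric.isBounded_closedBall.subset Set.sdiff_subset)).toFinset.card ≠ 12) :
    ¬ IsFree P s := by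
  rintro ⟨a, ha9, -, hclose⟩
  have ha : a ≠ 0 := by intro h0; rw [h0] at ha9; norm_num at ha9
  have h12 := card_eq_twelve_of_shellCloseTo hclose
  rw [card_shell P s ha] at h12
  exact h h12

/-- The window-free variant of freeness (any real scale `a`). -/
def IsFreeNoWindow (P : PC) (s : E3) : Prop :=
  ∃ a : ℝ, ShellCloseTo (1 / 20) (shell P s a) fccKissingPattern ∨ ShellCloseTo (1 / 20) (shell P s a) hcpKissingPattern

theorem IsFree.noWindow {P : PC} {s : E3} (h : IsFree P s) : IsFreeNoWindow P s := by
  obtain ⟨a, -, -, h⟩ := h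
  exact ⟨a, h⟩

/-- The crux with the scale window dropped (fewer sites charged). -/
def PSCNoWindow : Prop :=
  ∃ g : ℝ, 0 < g ∧ ∀ P : PC,
    ePer + g * (((P.motif.filter fun s => ¬ IsFreeNoWindow P s).card : ℝ) / (P.motif.card : ℝ)) ≤ e P

/-- **The scale window is not where the content is (formal direction).** Dropping `9/10 ≤ a ≤ 11/10`
charges fewer sites, so the crux implies the window-free variant with the same `g`. (Converse, on paper:
a free-without-window close-packed shell has all twelve points in `(6/5/√2, 6/5]`, and the only extra
freedom — nearest-neighbour distance in `(0.8485, 0.855) ∪ (1.155, 1.2]` — costs `≥ 0.3` per particle by the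
lattice sums of §N, far above any admissible `g`; so both variants stand or fall together.) -/
theorem psc_imp_pscNoWindow
    (h : Summit.AtomisticToContinuum.Crystallization.Theses.ReggeStarCoercivity.PeriodicStarCoercivity) :
    PSCNoWindow := by
  obtain ⟨g, hg, hP⟩ := psc_iff.1 h
  refine ⟨g, hg, fun P => le_trans ?_ ((pscAt_iff g P).1 (hP P))⟩
  have hsub : (P.motif.filter fun s => ¬ IsFreeNoWindow P s) ⊆ defectSet P := by
    intro s hs
    simp only [defectSet, Finset.mem_filter] at hs ⊢
    exact ⟨hs.1, fun hf => hs.2 hf.noWindow⟩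
  have hle : (((P.motif.filter fun s => ¬ IsFreeNoWindow P s).card : ℝ) / (P.motif.card : ℝ)) ≤
      defectFrac P :=
    div_le_div_of_nonneg_right (by exact_mod_cast Finset.card_le_card hsub) (motif_card_pos P).le
  nlinarith [mul_le_mul_of_nonneg_left hle hg.le]

/-- The site sum `h_P(x) = ∑_{y ∈ P.points, y ≠ x} V(|x − y|)` (twice the site energy). -/
def siteSum (P : PC) (x : E3) : ℝ :=
  ∑' y : {y : E3 // y ∈ P.points ∧ y ≠ x}, lennardJones (dist x y.1)

theorem e_eq_sum_siteSum (P : PC) :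
    e P = (2 * (P.motif.card : ℝ))⁻¹ * ∑ x ∈ P.motif, siteSum P x := rfl

/-- The PER-SITE strengthening: every defective site is charged `g` against HALF ITS OWN site energy. -/
def SiteCoercivity : Prop :=
  ∃ g : ℝ, 0 < g ∧ ∀ P : PC, ∀ s ∈ P.motif, ePer + g * (if IsFree P s then 0 else 1) ≤ siteSum P s / 2

/-- **Per-site ⇒ averaged.** `SiteCoercivity → PeriodicStarCoercivity` (average over the motif). A
refutation of the per-site form would therefore NOT refute the crux; it is recorded because the route's
level-1 ("raw simplex/site") bounds are per-site in spirit. See §5 for why even the per-site form resists a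
minimiser-free refutation. -/
theorem siteCoercivity_imp_psc (h : SiteCoercivity) :
    Summit.AtomisticToContinuum.Crystallization.Theses.ReggeStarCoercivity.PeriodicStarCoercivity := by
  obtain ⟨g, hg, hP⟩ := h
  refine psc_iff.2 ⟨g, hg, fun P => (pscAt_iff g P).2 ?_⟩
  have hM := motif_card_pos P
  -- sum the per-site inequalities over the motif
  have hsum : ∑ s ∈ P.motif, (ePer + g * (if IsFree P s then 0 else 1)) ≤ ∑ s ∈ P.motif, siteSum P s / 2 :=
    Finset.sum_le_sum fun s hs => hP P s hs
  have hind : ∑ s ∈ P.motif, (if IsFree P s then (0 : ℝ) else 1) = ((defectSet P).card : ℝ) := by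
    rw [Finset.sum_ite, Finset.sum_const_zero, zero_add, Finset.sum_const, nsmul_eq_mul, mul_one]
    rfl
  rw [Finset.sum_add_distrib, Finset.sum_const, nsmul_eq_mul, ← Finset.mul_sum, hind,
    ← Finset.sum_div] at hsum
  have he : e P = (∑ s ∈ P.motif, siteSum P s) / 2 / (P.motif.card : ℝ) := by
    rw [e_eq_sum_siteSum]; field_simp
  rw [he, defectFrac, le_div_iff₀ hM]
  have hcalc : (ePer + g * (((defectSet P).card : ℝ) / (P.motif.card : ℝ))) * (P.motif.card : ℝ) =
      (P.motif.card : ℝ) * ePer + g * ((defectSet P).card : ℝ) := by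
    field_simp
  rw [hcalc]
  exact hsum

/-! ## §3 Ceilings on `g` -/

theorem PSCAt.mono {g g' : ℝ} (hg : g' ≤ g) {P : PC} (h : PSCAt g P) : PSCAt g' P := by
  rw [pscAt_iff] at h ⊢
  nlinarith [defectFrac_nonneg P, mul_le_mul_of_nonneg_right hg (defectFrac_nonneg P)]

/-- Every everywhere-defective periodic configuration is a ceiling on `g`: `g ≤ e(P) − ePer`. Quantitative
use needs `ePer` from BELOW (§4); numerically (`ePer ≈ e(hcp) = −0.7176`) the ceilings of §N apply. -/
theorem g_le_of_allDefective {g : ℝ} {P : PC} (h : PSCAt g P) (hdef : ∀ s ∈ P.motif, ¬ IsFree P s) :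
    g ≤ e P - ePer := by
  rw [pscAt_iff, defectFrac_eq_one_of_forall hdef] at h
  linarith


/-! ## §4 `ePer` is a genuine infimum; what a lower bound buys -/

/-- The crux implies that periodic energies are bounded below (by `ePer` itself). -/
theorem psc_imp_bddBelow
    (h : Summit.AtomisticToContinuum.Crystallization.Theses.ReggeStarCoercivity.PeriodicStarCoercivity) :
    BddBelow (Set.range fun Q : PC => Q.energyPerParticle lennardJones) := by
  obtain ⟨g, hg, hP⟩ := psc_iff.1 h
  refine ⟨ePer, ?_⟩
  rintro _ ⟨Q, rfl⟩
  have := (pscAt_iff g Q).1 (hP Q)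
  have h0 : 0 ≤ g * defectFrac Q := mul_nonneg hg.le (defectFrac_nonneg Q)
  show ePer ≤ e Q
  linarith

/-- With periodic energies bounded below (PROVED in the evidence file `PeriodicStability.lean`, to be landed
as shared item 0714), `ePer ≤ e(P)` for every `P` … -/
theorem ePer_le (hB : BddBelow (Set.range fun Q : PC => Q.energyPerParticle lennardJones)) (P : PC) :
    ePer ≤ e P :=
  ciInf_le hB P

/-- The simple cubic lattice `ℤ³` as a periodic configuration (so `PC` is non-empty). -/
def cubic : PC where
  lattice := Literature.Algebra.EuclideanLattices.stdIntLattice 3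
  discrete := inferInstance
  isZLattice := inferInstance
  motif := {0}
  motif_nonempty := ⟨0, Finset.mem_singleton_self 0⟩
  eq_of_sub_mem := fun x hx y hy _ => by rw [Finset.mem_singleton.1 hx, Finset.mem_singleton.1 hy]

instance : Nonempty PC := ⟨cubic⟩

/-- … and every uniform lower bound passes to `ePer`. -/
theorem le_ePer {B : ℝ} (hB : ∀ Q : PC, B ≤ e Q) : B ≤ ePer :=
  le_ciInf hB

/-- The quantitative ceiling: an everywhere-defective `P` and a uniform lower bound `B` on periodic energies
give `g ≤ e(P) − B`. With the crude `B = −3·2²⁹` of `PeriodicStability.lean` this is vacuous in practice;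
the numerics of §N say the truth is `g ≲ 5·10⁻³`, which would need `B ≥ e(P_shuffle) − 5·10⁻³ ≈ −0.718`. -/
theorem g_le_of_allDefective_of_lowerBound {g B : ℝ} {P : PC} (h : PSCAt g P)
    (hdef : ∀ s ∈ P.motif, ¬ IsFree P s) (hB : ∀ Q : PC, B ≤ e Q) : g ≤ e P - B := by
  have h1 := g_le_of_allDefective h hdef
  have h2 := le_ePer hB
  linarith


/-! ## §4b An explicit everywhere-defective witness: the dilute cubic lattice `2ℤ³` -/

open Literature.Algebra.EuclideanLattices in
/-- The integer lattice instance with basis `2·I₃`, i.e. `2ℤ³`. -/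
abbrev twoCube : LatticeInstance := ⟨3, Matrix.diagonal fun _ => 2⟩

open Literature.Algebra.EuclideanLattices in
theorem twoCube_isNonsingular : twoCube.IsNonsingular := by
  show (Matrix.diagonal fun _ : Fin 3 => (2 : ℤ)).det ≠ 0
  rw [Matrix.det_diagonal]
  norm_num

open Literature.Algebra.EuclideanLattices in
/-- The dilute cubic configuration `2ℤ³` (one point per cell, nearest neighbours at distance `2 > 6/5`). -/
def dilute : PC where
  lattice := twoCube.lattice
  discrete := LatticeInstance.instDiscreteTopologyLattice twoCube
  isZLattice := LatticeInstance.isZLattice_of_isNonsingular twoCube_isNonsingular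
  motif := {0}
  motif_nonempty := ⟨0, Finset.mem_singleton_self 0⟩
  eq_of_sub_mem := fun x hx y hy _ => by rw [Finset.mem_singleton.1 hx, Finset.mem_singleton.1 hy]

open Literature.Algebra.EuclideanLattices in
/-- Non-zero points of `2ℤ³` have norm `≥ 2`. -/
theorem two_le_norm_of_mem_dilute {z : E3} (hz : z ∈ dilute.points) (hz0 : z ≠ 0) : 2 ≤ ‖z‖ := by
  obtain ⟨y, hy, g, hg, rfl⟩ := hz
  have hy0 : y = 0 := Finset.mem_singleton.1 hy
  subst hy0
  rw [zero_add] at hz0 ⊢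
  obtain ⟨v, rfl⟩ := (twoCube.mem_lattice_iff g).1 hg
  -- `ofCoeffs v = (2 v₀, 2 v₁, 2 v₂)`
  have hof : twoCube.ofCoeffs v = intVecToEuclidean 3 (fun j => v j * 2) := by
    show intVecToEuclidean 3 (Matrix.vecMul v (Matrix.diagonal fun _ => 2)) = _
    have hv : Matrix.vecMul v (Matrix.diagonal fun _ => (2 : ℤ)) = fun j => v j * 2 :=
      funext fun j => Matrix.vecMul_diagonal v _ j
    rw [hv]
  rw [hof] at hz0 ⊢
  have hv : ∃ j, v j ≠ 0 := by
    by_contra hall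
    push Not at hall
    apply hz0
    have : (fun j => v j * 2) = 0 := by funext j; simp [hall j]
    rw [this, map_zero]
  obtain ⟨j, hj⟩ := hv
  rw [norm_intVecToEuclidean]
  have hsq : (4 : ℝ) ≤ ∑ i, (((fun j => v j * 2) i : ℤ) : ℝ) ^ 2 := by
    have hj1 : (1 : ℝ) ≤ ((v j : ℤ) : ℝ) ^ 2 := by
      have : 1 ≤ |v j| := Int.one_le_abs hj
      have h' : (1 : ℝ) ≤ |((v j : ℤ) : ℝ)| := by exact_mod_cast this
      nlinarith [abs_nonneg (((v j : ℤ) : ℝ)), sq_abs (((v j : ℤ) : ℝ))]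
    have hterm : (4 : ℝ) ≤ (((fun j => v j * 2) j : ℤ) : ℝ) ^ 2 := by
      push_cast
      nlinarith
    exact hterm.trans (Finset.single_le_sum (f := fun i => (((fun j => v j * 2) i : ℤ) : ℝ) ^ 2)
      (fun i _ => sq_nonneg _) (Finset.mem_univ j))
  calc (2 : ℝ) = √4 := by rw [show (4 : ℝ) = 2 ^ 2 by norm_num, Real.sqrt_sq (by norm_num)]
    _ ≤ _ := Real.sqrt_le_sqrt hsq

/-- The raw first shell of the origin in `2ℤ³` is EMPTY (nothing but the origin within `6/5`). -/
theorem shell_dilute_empty :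
    (dilute.finite_inter_points (K := Metric.closedBall (0 : E3) (6 / 5) \ {0})
      (Metric.isBounded_closedBall.subset Set.sdiff_subset)).toFinset = ∅ := by
  rw [Set.Finite.toFinset_eq_empty, Set.eq_empty_iff_forall_notMem]
  rintro z ⟨⟨hzball, hz0⟩, hzpts⟩
  have h2 := two_le_norm_of_mem_dilute hzpts hz0
  rw [Metric.mem_closedBall, dist_zero_right] at hzball
  linarith

/-- Hence the origin of `2ℤ³` is defective, for every scale window (`not_isFree_of_card_ne`). -/
theorem not_isFree_dilute : ¬ IsFree dilute 0 :=
  not_isFree_of_card_ne dilute 0 (by rw [shell_dilute_empty]; decide)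

theorem defectFrac_dilute : defectFrac dilute = 1 :=
  defectFrac_eq_one_of_forall fun s hs => by
    have : s = 0 := Finset.mem_singleton.1 hs
    subst this
    exact not_isFree_dilute

/-- All pair distances in `2ℤ³` are `≥ 2 ≥ 1`, where `V_LJ ≤ 0`; so `e(2ℤ³) ≤ 0`. -/
theorem e_dilute_le_zero : e dilute ≤ 0 := by
  show (2 * ((dilute.motif.card : ℕ) : ℝ))⁻¹ *
    ∑ x ∈ dilute.motif, ∑' y : {y : E3 // y ∈ dilute.points ∧ y ≠ x}, lennardJones (dist x y.1) ≤ 0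
  have hmotif : dilute.motif = {0} := rfl
  rw [hmotif, Finset.sum_singleton]
  refine mul_nonpos_of_nonneg_of_nonpos (by positivity) (tsum_nonpos fun y => ?_)
  have h2 : 2 ≤ ‖(y : E3)‖ := two_le_norm_of_mem_dilute y.2.1 y.2.2
  rw [dist_comm, dist_zero_right]
  set r := ‖(y : E3)‖ with hr
  have hr1 : 1 ≤ r := by linarith
  have hle : (r⁻¹) ^ 6 ≤ 1 := pow_le_one₀ (inv_nonneg.2 (by linarith)) (inv_le_one_of_one_le₀ hr1)
  have h0 : 0 ≤ (r⁻¹) ^ 6 := by positivity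
  show 1 / 12 * r⁻¹ ^ 12 - 1 / 6 * r⁻¹ ^ 6 ≤ 0
  nlinarith [show r⁻¹ ^ 12 = (r⁻¹ ^ 6) ^ 2 by ring]

/-- **Ceiling from the dilute witness.** Any admissible `g` satisfies `g ≤ −ePer`; in particular the crux
implies `ePer < 0` … -/
theorem g_le_neg_ePer {g : ℝ} (h : PSCAt g dilute) : g ≤ -ePer := by
  have := g_le_of_allDefective h fun s hs => by
    have : s = 0 := Finset.mem_singleton.1 hs
    subst this; exact not_isFree_dilute
  linarith [e_dilute_le_zero]

theorem psc_imp_ePer_neg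
    (h : Summit.AtomisticToContinuum.Crystallization.Theses.ReggeStarCoercivity.PeriodicStarCoercivity) :
    ePer < 0 := by
  obtain ⟨g, hg, hP⟩ := psc_iff.1 h
  have := g_le_neg_ePer (hP dilute)
  linarith

/-- … and, with the periodic Yuhjtman bound `e(Q) ≥ −14.316/12` for all periodic `Q ⊂ ℝ³` (PROVED sorry-free in
the evidence file `PeriodicBlocks.lean`, `energyPerParticle_ge_yuhjtman`, via trial blocks + the tree's
`Yuhjtman2015_stabilityConstant_holds`; stated here as a hypothesis until that file is landed in Literature),
every admissible `g` is `≤ 14.316/12 ≈ 1.193`: the strengthening "`g = 6/5` works" is refuted. -/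
theorem g_le_yuhjtman (hY : ∀ Q : PC, -(14.316 / 12 : ℝ) ≤ e Q) {g : ℝ} (h : PSCAt g dilute) :
    g ≤ 14.316 / 12 := by
  have h1 := g_le_neg_ePer h
  have h2 := le_ePer hY
  linarith

theorem not_pscAt_six_fifths (hY : ∀ Q : PC, -(14.316 / 12 : ℝ) ≤ e Q) : ¬ ∀ P : PC, PSCAt (6 / 5) P :=
  fun h => by have := g_le_yuhjtman hY (h dilute); norm_num at this


/-! ## §4c A denser everywhere-defective witness: bcc at nearest-neighbour distance `0.9526`

`bcc = (11/20)·{integer vectors with all coordinates of the same parity}` (conventional cube `11/10`,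
nearest neighbours `(11/20)√3 ≈ 0.9526`, second neighbours `11/10`): every site has `8 + 6 = 14` points
within `6/5`, so it is defective for every scale window; and dropping all but the first five shells of the
lattice sum (all omitted terms are `≤ 0` since every pair distance is `≥ 0.95 > 2^{-1/6}`) certifies
`e(bcc) ≤ −0.633`. Hence `ePer ≤ −0.633` (mod `BddBelow`, evidence) and every admissible `g ≤ 0.56` (mod the
periodic Yuhjtman floor, evidence). -/

open Literature.Algebra.EuclideanLattices in
/-- Integer basis of the bcc lattice `{v ∈ ℤ³ : v₀ ≡ v₁ ≡ v₂ mod 2}` (conventional cube of side 2). -/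
abbrev bccMat : Matrix (Fin 3) (Fin 3) ℤ := !![1, 1, -1; 1, -1, 1; -1, 1, 1]

open Literature.Algebra.EuclideanLattices in
abbrev bccI : LatticeInstance := ⟨3, bccMat⟩

open Literature.Algebra.EuclideanLattices in
theorem bccI_isNonsingular : bccI.IsNonsingular := by
  show bccMat.det ≠ 0
  rw [Matrix.det_fin_three]
  simp [bccMat]

theorem vecMul_bccMat (z : Fin 3 → ℤ) :
    Matrix.vecMul z bccMat = ![z 0 + z 1 - z 2, z 0 - z 1 + z 2, -z 0 + z 1 + z 2] := by
  ext i
  fin_cases i <;> simp [Matrix.vecMul, dotProduct, Fin.sum_univ_three] <;> ring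

/-- The coefficient vector of a same-parity integer vector. -/
def bccCoeff (w : Fin 3 → ℤ) : Fin 3 → ℤ := ![(w 0 + w 1) / 2, (w 0 + w 2) / 2, (w 1 + w 2) / 2]

/-- The scaling map `x ↦ (20/11) x` as a continuous linear automorphism of `ℝ³`. -/
def unscale : E3 ≃L[ℝ] E3 :=
  (LinearEquiv.smulOfNeZero ℝ E3 (20 / 11 : ℝ) (by norm_num)).toContinuousLinearEquiv

theorem unscale_apply (x : E3) : unscale x = (20 / 11 : ℝ) • x := rfl

open Literature.Algebra.EuclideanLattices in
/-- **bcc** at conventional cube `11/10`: lattice `(11/20)·L(bccMat)`, one point per cell. -/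
def bcc : PC where
  lattice := ZLattice.comap ℝ bccI.lattice unscale.toLinearEquiv.toLinearMap
  discrete := by
    haveI : DiscreteTopology ↥bccI.lattice := LatticeInstance.instDiscreteTopologyLattice bccI
    exact ZLattice.comap_discreteTopology ℝ bccI.lattice (e := unscale.toLinearEquiv.toLinearMap)
      unscale.continuous unscale.injective
  isZLattice := by
    haveI : DiscreteTopology ↥bccI.lattice := LatticeInstance.instDiscreteTopologyLattice bccI
    haveI := LatticeInstance.isZLattice_of_isNonsingular bccI_isNonsingular
    exact instIsZLatticeComap ℝ bccI.lattice unscale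
  motif := {0}
  motif_nonempty := ⟨0, Finset.mem_singleton_self 0⟩
  eq_of_sub_mem := fun x hx y hy _ => by rw [Finset.mem_singleton.1 hx, Finset.mem_singleton.1 hy]

open Literature.Algebra.EuclideanLattices in
/-- The bcc point with integer label `w` (a same-parity vector): `(11/20)·w`. -/
def bccPt (w : Fin 3 → ℤ) : E3 := (11 / 20 : ℝ) • intVecToEuclidean 3 w

open Literature.Algebra.EuclideanLattices in
theorem mem_lattice_bcc_iff (x : E3) :
    x ∈ bcc.lattice ↔ ∃ z : Fin 3 → ℤ, x = bccPt (Matrix.vecMul z bccMat) := by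
  show (20 / 11 : ℝ) • x ∈ bccI.lattice ↔ _
  rw [bccI.mem_lattice_iff]
  constructor
  · rintro ⟨z, hz⟩
    refine ⟨z, ?_⟩
    have : x = (11 / 20 : ℝ) • ((20 / 11 : ℝ) • x) := by rw [smul_smul]; norm_num
    rw [this, ← hz]
    rfl
  · rintro ⟨z, rfl⟩
    refine ⟨z, ?_⟩
    show intVecToEuclidean 3 (Matrix.vecMul z bccMat) = (20 / 11 : ℝ) • ((11 / 20 : ℝ) • _)
    rw [smul_smul]; norm_num

theorem mem_points_bcc_iff (x : E3) :
    x ∈ bcc.points ↔ ∃ z : Fin 3 → ℤ, x = bccPt (Matrix.vecMul z bccMat) := by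
  rw [← mem_lattice_bcc_iff]
  constructor
  · rintro ⟨y, hy, g, hg, rfl⟩
    have : y = 0 := Finset.mem_singleton.1 hy
    subst this
    rwa [zero_add]
  · intro hx
    exact ⟨0, Finset.mem_singleton_self 0, x, hx, (zero_add x).symm⟩

open Literature.Algebra.EuclideanLattices in
/-- A same-parity vector is a bcc label: `bccCoeff w ᵥ* bccMat = w`. -/
theorem vecMul_bccCoeff {w : Fin 3 → ℤ} (h01 : (w 0 + w 1) % 2 = 0) (h02 : (w 0 + w 2) % 2 = 0) :
    Matrix.vecMul (bccCoeff w) bccMat = w := by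
  rw [vecMul_bccMat]
  have h12 : (w 1 + w 2) % 2 = 0 := by omega
  ext i
  fin_cases i <;> simp [bccCoeff] <;> omega

theorem bccPt_mem_points {w : Fin 3 → ℤ} (h01 : (w 0 + w 1) % 2 = 0) (h02 : (w 0 + w 2) % 2 = 0) :
    bccPt w ∈ bcc.points :=
  (mem_points_bcc_iff _).2 ⟨bccCoeff w, by rw [vecMul_bccCoeff h01 h02]⟩

open Literature.Algebra.EuclideanLattices in
theorem norm_bccPt (w : Fin 3 → ℤ) : ‖bccPt w‖ = (11 / 20 : ℝ) * √(∑ j, ((w j : ℤ) : ℝ) ^ 2) := by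
  rw [bccPt, norm_smul, norm_intVecToEuclidean, Real.norm_of_nonneg (by norm_num)]

open Literature.Algebra.EuclideanLattices in
theorem bccPt_injective : Function.Injective bccPt := by
  intro v w h
  have h' : intVecToEuclidean 3 v = intVecToEuclidean 3 w := by
    have := congrArg (fun x : E3 => (20 / 11 : ℝ) • x) h
    simpa [bccPt, smul_smul] using this
  exact intVecToEuclidean_injective 3 h'

theorem bccPt_ne_zero {w : Fin 3 → ℤ} (hw : w ≠ 0) : bccPt w ≠ 0 := by
  intro h
  apply hw
  have h0 : bccPt 0 = 0 := by simp [bccPt]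
  rw [← h0] at h
  exact bccPt_injective h

/-- Non-zero bcc labels have squared length `≥ 3` (all-odd: each square `≥ 1`; all-even: one square `≥ 4`). -/
theorem three_le_sqNorm_vecMul {z : Fin 3 → ℤ} (hz : Matrix.vecMul z bccMat ≠ 0) :
    (3 : ℝ) ≤ ∑ j, (((Matrix.vecMul z bccMat) j : ℤ) : ℝ) ^ 2 := by
  rw [vecMul_bccMat] at hz ⊢
  set a := z 0 + z 1 - z 2 with ha
  set b := z 0 - z 1 + z 2 with hb
  set c := -z 0 + z 1 + z 2 with hc
  have hne : ¬ (a = 0 ∧ b = 0 ∧ c = 0) := by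
    rintro ⟨h1, h2, h3⟩
    apply hz
    ext i; fin_cases i <;> simp [h1, h2, h3]
  simp only [Fin.sum_univ_three, Matrix.cons_val_zero, Matrix.cons_val_one, Matrix.cons_val_two,
    Matrix.head_cons, Matrix.tail_cons]
  -- parity: a ≡ b ≡ c (mod 2)
  have hab : (a + b) % 2 = 0 := by omega
  have hac : (a + c) % 2 = 0 := by omega
  have key : (3 : ℤ) ≤ a ^ 2 + b ^ 2 + c ^ 2 := by
    rcases Int.emod_two_eq_zero_or_one a with h0 | h1
    · -- all even, not all zero: one of them has absolute value ≥ 2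
      have hb0 : b % 2 = 0 := by omega
      have hc0 : c % 2 = 0 := by omega
      by_cases hA : a = 0
      · by_cases hB : b = 0
        · have hC : c ≠ 0 := fun h => hne ⟨hA, hB, h⟩
          have : 2 ≤ c ∨ c ≤ -2 := by omega
          rcases this with h | h <;> nlinarith
        · have : 2 ≤ b ∨ b ≤ -2 := by omega
          rcases this with h | h <;> nlinarith [sq_nonneg a, sq_nonneg c]
      · have : 2 ≤ a ∨ a ≤ -2 := by omega
        rcases this with h | h <;> nlinarith [sq_nonneg b, sq_nonneg c]
    · have : (1 ≤ a ∨ a ≤ -1) ∧ (1 ≤ b ∨ b ≤ -1) ∧ (1 ≤ c ∨ c ≤ -1) := by omega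
      obtain ⟨ha', hb', hc'⟩ := this
      have h1' : 1 ≤ a ^ 2 := by rcases ha' with h | h <;> nlinarith
      have h2' : 1 ≤ b ^ 2 := by rcases hb' with h | h <;> nlinarith
      have h3' : 1 ≤ c ^ 2 := by rcases hc' with h | h <;> nlinarith
      linarith
  exact_mod_cast key

/-- Every non-zero point of bcc is at distance `≥ (11/20)√3 > 2^{-1/6}` from the origin, where `V ≤ 0`. -/
theorem lennardJones_norm_nonpos_of_mem_bcc {x : E3} (hx : x ∈ bcc.points) (hx0 : x ≠ 0) :
    lennardJones ‖x‖ ≤ 0 := by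
  obtain ⟨z, rfl⟩ := (mem_points_bcc_iff x).1 hx
  have hz : Matrix.vecMul z bccMat ≠ 0 := fun h => hx0 (by rw [h]; simp [bccPt])
  have h3 := three_le_sqNorm_vecMul hz
  rw [norm_bccPt]
  set k := ∑ j, (((Matrix.vecMul z bccMat) j : ℤ) : ℝ) ^ 2 with hk
  set r := (11 / 20 : ℝ) * √k with hr
  have hk3 : √3 ≤ √k := Real.sqrt_le_sqrt h3
  have hs3 : (17 / 10 : ℝ) ≤ √3 := by
    rw [show (17 / 10 : ℝ) = √((17/10)^2) by rw [Real.sqrt_sq (by norm_num)]]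
    exact Real.sqrt_le_sqrt (by norm_num)
  have hr1 : (187 / 200 : ℝ) ≤ r := by rw [hr]; nlinarith
  have hrpos : 0 < r := by linarith
  -- `V(r) = (1/12) r⁻⁶ (r⁻⁶ − 2) ≤ 0` since `r⁶ ≥ (187/200)⁶ > 1/2`
  have hr6 : (1 / 2 : ℝ) ≤ r ^ 6 := by
    have : ((187 : ℝ) / 200) ^ 6 ≤ r ^ 6 := pow_le_pow_left₀ (by norm_num) hr1 6
    have h' : (1 / 2 : ℝ) ≤ ((187 : ℝ) / 200) ^ 6 := by norm_num
    linarith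
  have hinv : r⁻¹ ^ 6 ≤ 2 := by
    rw [inv_pow, inv_le_comm₀ (by positivity) (by norm_num)]
    linarith
  have h0 : 0 ≤ r⁻¹ ^ 6 := by positivity
  show 1 / 12 * r⁻¹ ^ 12 - 1 / 6 * r⁻¹ ^ 6 ≤ 0
  nlinarith [show r⁻¹ ^ 12 = (r⁻¹ ^ 6) ^ 2 by ring]


/-- Labels of the first two bcc shells (the `14` points within `6/5` of a site). -/
def W14 : Finset (Fin 3 → ℤ) :=
  {![-1, -1, -1], ![-1, -1, 1], ![-1, 1, -1], ![-1, 1, 1], ![1, -1, -1], ![1, -1, 1], ![1, 1, -1], ![1, 1, 1],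
   ![-2, 0, 0], ![0, -2, 0], ![0, 0, -2], ![0, 0, 2], ![0, 2, 0], ![2, 0, 0]}

/-- Labels of the first five bcc shells (`|w|² ∈ {3, 4, 8, 11, 12}`, `8 + 6 + 12 + 24 + 8 = 58` points). -/
def W58 : Finset (Fin 3 → ℤ) :=
  {![-1, -1, -1], ![-1, -1, 1], ![-1, 1, -1], ![-1, 1, 1], ![1, -1, -1], ![1, -1, 1], ![1, 1, -1],
   ![1, 1, 1], ![-2, 0, 0], ![0, -2, 0], ![0, 0, -2], ![0, 0, 2], ![0, 2, 0], ![2, 0, 0],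
   ![-2, -2, 0], ![-2, 0, -2], ![-2, 0, 2], ![-2, 2, 0], ![0, -2, -2], ![0, -2, 2], ![0, 2, -2],
   ![0, 2, 2], ![2, -2, 0], ![2, 0, -2], ![2, 0, 2], ![2, 2, 0], ![-3, -1, -1], ![-3, -1, 1],
   ![-3, 1, -1], ![-3, 1, 1], ![-1, -3, -1], ![-1, -3, 1], ![-1, -1, -3], ![-1, -1, 3],
   ![-1, 1, -3], ![-1, 1, 3], ![-1, 3, -1], ![-1, 3, 1], ![1, -3, -1], ![1, -3, 1], ![1, -1, -3],
   ![1, -1, 3], ![1, 1, -3], ![1, 1, 3], ![1, 3, -1], ![1, 3, 1], ![3, -1, -1], ![3, -1, 1],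
   ![3, 1, -1], ![3, 1, 1], ![-2, -2, -2], ![-2, -2, 2], ![-2, 2, -2], ![-2, 2, 2], ![2, -2, -2],
   ![2, -2, 2], ![2, 2, -2], ![2, 2, 2]}

/-- The squared label length. -/
def sqN (w : Fin 3 → ℤ) : ℤ := ∑ j, w j ^ 2

theorem W14_good : ∀ w ∈ W14, (w 0 + w 1) % 2 = 0 ∧ (w 0 + w 2) % 2 = 0 ∧ w ≠ 0 ∧ sqN w ≤ 4 := by
  decide

theorem card_W14 : W14.card = 14 := by decide

set_option maxRecDepth 100000 in
theorem W58_good : ∀ w ∈ W58, (w 0 + w 1) % 2 = 0 ∧ (w 0 + w 2) % 2 = 0 ∧ w ≠ 0 := by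
  decide +kernel

set_option maxRecDepth 100000 in
theorem W58_sqN : W58.val.map sqN =
    Multiset.replicate 8 3 + Multiset.replicate 6 4 + Multiset.replicate 12 8 +
      Multiset.replicate 24 11 + Multiset.replicate 8 12 := by
  decide +kernel

theorem sum_sq_cast (w : Fin 3 → ℤ) : ∑ j, ((w j : ℤ) : ℝ) ^ 2 = ((sqN w : ℤ) : ℝ) := by
  unfold sqN; push_cast; rfl

/-- The 14 first- and second-shell points lie in the raw first shell of the origin … -/
theorem image_W14_subset_shell :
    W14.image bccPt ⊆ (bcc.finite_inter_points (K := Metric.closedBall (0 : E3) (6 / 5) \ {0})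
      (Metric.isBounded_closedBall.subset Set.sdiff_subset)).toFinset := by
  intro x hx
  obtain ⟨w, hw, rfl⟩ := Finset.mem_image.1 hx
  obtain ⟨h01, h02, hne, hsq⟩ := W14_good w hw
  rw [Set.Finite.mem_toFinset]
  refine ⟨⟨?_, bccPt_ne_zero hne⟩, bccPt_mem_points h01 h02⟩
  rw [Metric.mem_closedBall, dist_zero_right, norm_bccPt, sum_sq_cast]
  have h4 : ((sqN w : ℤ) : ℝ) ≤ 4 := by exact_mod_cast hsq
  have : √((sqN w : ℤ) : ℝ) ≤ 2 := by
    rw [show (2 : ℝ) = √(2 ^ 2) by rw [Real.sqrt_sq (by norm_num)]]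
    exact Real.sqrt_le_sqrt (by linarith)
  nlinarith [Real.sqrt_nonneg (((sqN w : ℤ) : ℝ))]

/-- … so the origin of bcc is over-coordinated (`≥ 14 ≠ 12` points within `6/5`): defective for every window. -/
theorem not_isFree_bcc : ¬ IsFree bcc 0 := by
  apply not_isFree_of_card_ne
  intro h12
  have hcard : (W14.image bccPt).card = 14 := by
    rw [Finset.card_image_of_injective _ bccPt_injective, card_W14]
  have := Finset.card_le_card image_W14_subset_shell
  rw [hcard, h12] at this
  norm_num at this

/-- The first-shell-sum evaluation: `V((11/20)√k)` as a rational function of `k`. -/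
theorem lennardJones_bcc_label (w : Fin 3 → ℤ) :
    lennardJones ‖bccPt w‖ =
      1 / 12 * ((121 / 400 : ℝ) * ((sqN w : ℤ) : ℝ))⁻¹ ^ 6 - 1 / 6 * ((121 / 400 : ℝ) * ((sqN w : ℤ) : ℝ))⁻¹ ^ 3 := by
  rw [norm_bccPt, sum_sq_cast]
  set k : ℝ := ((sqN w : ℤ) : ℝ) with hk
  have hk0 : 0 ≤ k := by
    rw [hk, ← sum_sq_cast]; positivity
  have hsq : ((11 / 20 : ℝ) * √k) ^ 2 = 121 / 400 * k := by
    rw [mul_pow, Real.sq_sqrt hk0]; norm_num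
  show 1 / 12 * ((11 / 20 : ℝ) * √k)⁻¹ ^ 12 - 1 / 6 * ((11 / 20 : ℝ) * √k)⁻¹ ^ 6 = _
  rw [show ((11 / 20 : ℝ) * √k)⁻¹ ^ 12 = ((((11 / 20 : ℝ) * √k) ^ 2)⁻¹) ^ 6 by rw [inv_pow, inv_pow, ← pow_mul],
    show ((11 / 20 : ℝ) * √k)⁻¹ ^ 6 = ((((11 / 20 : ℝ) * √k) ^ 2)⁻¹) ^ 3 by rw [inv_pow, inv_pow, ← pow_mul], hsq]

/-- **Certified partial lattice sum**: the first five shells of bcc give `∑_{58} V ≤ −1.266`. -/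
theorem sum_W58_le : ∑ w ∈ W58, lennardJones ‖bccPt w‖ ≤ -(1266 / 1000 : ℝ) := by
  simp only [lennardJones_bcc_label]
  have hms : ∀ F : ℤ → ℝ, ∑ w ∈ W58, F (sqN w) =
      8 * F 3 + 6 * F 4 + 12 * F 8 + 24 * F 11 + 8 * F 12 := by
    intro F
    rw [Finset.sum_eq_multiset_sum]
    show (Multiset.map (F ∘ sqN) W58.val).sum = _
    rw [← Multiset.map_map F sqN, W58_sqN]
    simp only [Multiset.map_add, Multiset.map_replicate, Multiset.sum_add, Multiset.sum_replicate, nsmul_eq_mul]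
    push_cast; ring
  rw [hms (fun k => 1 / 12 * ((121 / 400 : ℝ) * ((k : ℤ) : ℝ))⁻¹ ^ 6 - 1 / 6 * ((121 / 400 : ℝ) * ((k : ℤ) : ℝ))⁻¹ ^ 3)]
  norm_num

/-- **`e(bcc) ≤ −0.633`**: drop every term of the (non-positive) lattice sum except the first five shells. -/
theorem e_bcc_le : e bcc ≤ -(633 / 1000 : ℝ) := by
  show (2 * ((bcc.motif.card : ℕ) : ℝ))⁻¹ *
    ∑ x ∈ bcc.motif, ∑' y : {y : E3 // y ∈ bcc.points ∧ y ≠ x}, lennardJones (dist x y.1) ≤ _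
  have hmotif : bcc.motif = {0} := rfl
  rw [hmotif, Finset.sum_singleton, Finset.card_singleton]
  -- the full site sum at the origin is below its 58-term partial sum
  set f : {y : E3 // y ∈ bcc.points ∧ y ≠ 0} → ℝ := fun y => lennardJones (dist 0 y.1) with hf
  have hsum : Summable f := bcc.summable_lennardJones_dist_three 0
  have hf0 : ∀ y, f y ≤ 0 := fun y => by
    simp only [hf, dist_zero_left]
    exact lennardJones_norm_nonpos_of_mem_bcc y.2.1 y.2.2
  -- the 58 points as elements of the index type
  set φ : {w // w ∈ W58} → {y : E3 // y ∈ bcc.points ∧ y ≠ 0} := fun w =>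
    ⟨bccPt w.1, bccPt_mem_points (W58_good w.1 w.2).1 (W58_good w.1 w.2).2.1,
      bccPt_ne_zero (W58_good w.1 w.2).2.2⟩ with hφ
  have hφinj : Function.Injective φ := by
    intro a b h
    have : bccPt a.1 = bccPt b.1 := congrArg Subtype.val h
    exact Subtype.ext (bccPt_injective this)
  set s : Finset {y : E3 // y ∈ bcc.points ∧ y ≠ 0} := Finset.univ.image φ with hs
  have hle : ∑' y, f y ≤ ∑ y ∈ s, f y := by
    have hneg : ∑ y ∈ s, (-f y) ≤ ∑' y, (-f y) :=
      hsum.neg.sum_le_tsum s fun y _ => neg_nonneg.2 (hf0 y)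
    rw [tsum_neg, Finset.sum_neg_distrib] at hneg
    linarith
  have hs_eval : ∑ y ∈ s, f y = ∑ w ∈ W58, lennardJones ‖bccPt w‖ := by
    rw [hs, Finset.sum_image fun a _ b _ h => hφinj h]
    rw [← Finset.sum_coe_sort W58]
    refine Finset.sum_congr rfl fun w _ => ?_
    simp only [hf, hφ, dist_zero_left]
  have h58 := sum_W58_le
  rw [hs_eval] at hle
  have : ∑' y, f y ≤ -(1266 / 1000 : ℝ) := hle.trans h58
  have h2 : (2 * ((1 : ℕ) : ℝ))⁻¹ = 1 / 2 := by norm_num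
  rw [h2]
  linarith

theorem defectFrac_bcc : defectFrac bcc = 1 :=
  defectFrac_eq_one_of_forall fun s hs => by
    have : s = 0 := Finset.mem_singleton.1 hs
    subst this
    exact not_isFree_bcc

/-- **Ceilings from bcc.** `ePer ≤ −0.633` once periodic energies are bounded below (evidence) … -/
theorem ePer_le_bcc (hB : BddBelow (Set.range fun Q : PC => Q.energyPerParticle lennardJones)) :
    ePer ≤ -(633 / 1000 : ℝ) :=
  (ePer_le hB bcc).trans e_bcc_le

/-- … and every admissible `g` is `≤ 1.193 − 0.633 = 0.56` (mod the periodic Yuhjtman floor, evidence):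
the strengthening "`g = 3/5` works" is refuted. -/
theorem g_le_bcc_yuhjtman (hY : ∀ Q : PC, -(14.316 / 12 : ℝ) ≤ e Q) {g : ℝ} (h : PSCAt g bcc) :
    g ≤ 56 / 100 := by
  have h1 := g_le_of_allDefective_of_lowerBound h (fun s hs => by
    have : s = 0 := Finset.mem_singleton.1 hs
    subst this; exact not_isFree_bcc) hY
  have h2 := e_bcc_le
  norm_num at h1 h2 ⊢
  linarith

theorem not_pscAt_three_fifths (hY : ∀ Q : PC, -(14.316 / 12 : ℝ) ≤ e Q) : ¬ ∀ P : PC, PSCAt (3 / 5) P :=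
  fun h => by have := g_le_bcc_yuhjtman hY (h bcc); norm_num at this

end Summit.AtomisticToContinuum.Crystallization.Cruxes.PeriodicStarCoercivity.Disproof

/-!
## §5 Dead ends and near-misses (gen 2), for the provers

1. PER-SITE VARIANT. To refute `SiteCoercivity` without knowing `ePer` one would take a near-minimiser `Q`
   (`e(Q) < ePer + ε`, which exists by `⨅` alone, bounded below or not), pick a motif site `s₀` with
   `h_Q(s₀)/2 ≤ e(Q)`, and adjoin the orbit of a new point `y*` with `0.95 ≤ |y* − s₀| ≤ 6/5` so that `s₀`
   becomes 13-coordinated (defective, `not_isFree_of_card_ne`) while `h(s₀)` DECREASES (`V < 0` on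
   `(2^{-1/6}, ∞)`), provided no other orbit point `y* + g`, `g ≠ 0`, lands within `2^{-1/6}` of `s₀`. That
   proviso needs the lattice of the UNKNOWN near-minimiser to have no short vectors; scaling-stability gives
   only `min |g| ≥ (48 B)^{-1/12}` from a periodic stability constant `B` (`≈ 0.71` even with Yuhjtman's
   `B = 1.193`), which still allows `~150` lattice points within `2.1` of `s₀` whose exclusion balls cover the
   annulus. Dead end: needs the structure of near-minimisers (crystallization itself).
2. RADIUS VARIANTS. Replacing `6/5` by `R`: for `R ≥ √2 · d* ≈ 1.374` (second shell of the optimal close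
   packing enters) or `R < d* ≈ 0.971` every site of hcp/fcc at the optimal density is defective, so the
   variant is "morally false" (frac → 1 along near-minimisers); for `R ∈ [1.02, 1.30]` nothing changes. None of
   this is provable without identifying the minimiser; `6/5` sits safely inside the gap `(d*, √2 d*)`.
3. THRESHOLD CROSSINGS. Freeness is a CLOSED condition (compact window × O(3) × finitely many bijections,
   non-strict `≤ 1/20`), so configurations exactly at 5 % distortion are free; the defect indicator jumps only
   at strictly positive strain, where the excess is already `≳ μ_min (d*/20)²/2 ≈ 5·10⁻³` per site (softest
   mode: basal optical shuffle / incipient Shockley slide). A kill needs a zero-excess configuration ON the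
   threshold — i.e. a defective periodic minimiser.
4. POROUS / TWO-PHASE / POINT DEFECTS. Isolated atoms and surfaces pay `≈ |ePer| ≈ 0.72` resp. `≈ 0.3` per
   defective site; vacancy `≈ 0.72/12 = 0.06`; octahedral interstitial `≫ 1`; mixing an everywhere-defective
   phase X with hcp in slabs tends to `e_X − e_hcp ≥ 10⁻²`. Ratios bounded below throughout.
5. 13TH-NEIGHBOUR INTRUSION at zero strain is impossible near the optimum (`√2 d* = 1.374 > 6/5`); forcing a
   13th point into radius `6/5` costs packing strain `≳ 10⁻²`.
-/
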